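import Summits.QuantumFields.BalabanUV.T4Continuum.Support.RegularTowerSubdivision

/-!
# RegularTowerSubdivisionParent — PARENT CONSISTENCY of the `R`-adic box-spline subdivision: the refined family stays within `2d` Lipschitz units
# of its parent (`‖subdiv w x − w (parT x)‖ ≤ 2d·b`)

Cell `pub-balaban`, unit `b2b-balaban-t4-ne5-p1` (row NE5 OWNER, gen 41; owner item «S1» of RULING R63, second half — split from
`RegularTowerSubdivision` for the 400-line rule).  Summits-side NEW WORK under the LEAN PLACEMENT RULE ([folklore] lattice bookkeeping on OUR typed
objects; 0 `def`; nothing printed is asserted; no citation tags).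

WHAT ([folklore]; generic normed `ℂ`-space `E`).  `par_add_off` (`par (y + off j) = par y + Σ_ν carry_ν·e_ν`, carries `0∕1` decided by the own offsets —
each coordinate crosses at most one block face), the path lemmas `norm_sub_sum_tstep_le'` (any torus, any step counts) ∕ `norm_sub_le_of_short_path`,
`norm_parT_add_off_add_off_sub_le` (two block offsets move the parent by at most `2d` unit steps), and the END
**`norm_subdiv_sub_parT_le`**: `0 ≤ b → (∀ μ i, ‖w (τ_μ i) − w i‖ ≤ b) → ‖subdiv w x − w (parT x)‖ ≤ 2d·b` — at tower level (`R = L`, `b = β∕L^k`) the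
subdivided connection at a fine bond is within `2dβ∕L^k` of the connection at the parent bond: the `LocalRate`-type two-level consistency of the padded
levels (R63 road P′; consumed by `RegularTowerPadding`).
HONEST FRAMING: rung (B)+1 bookkeeping of the FINITE-VOLUME T⁴ programme — NOT infinite volume, NOT a mass gap, NOT Clay; NE5 ∕ NE2 NOT PRINTED ∕ NOT PROVED;
spine 0∕9; nothing of Bałaban's is asserted or instantiated.  HONEST DEPENDENCY (cell line, verbatim): continuum YM on T⁴ ⇐ BetaPertH ∧ nine spine estimates
(0/9 proved); BetaPertH ⇐ (D1) ∧ (D4) ∧ CAP+tail; G-an2-4 gates asym, D1 and NE2/3/4.  0 sorry; axioms ⊆ {propext, Classical.choice, Quot.sound}.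
-/

noncomputable section

open scoped BigOperators Matrix Matrix.Norms.L2Operator

namespace Summit.QuantumFields.BalabanUV.T4Continuum.RegularTowerSubdivision

open Literature.MathematicalPhysics.QuantumFieldTheory.Balaban1983to89.B5Prop11Plancherel (fine Tor unitVec)
open Literature.MathematicalPhysics.QuantumFieldTheory.Balaban1983to89.B5Block118 (tstep tstep_zero tstep_succ)
open Literature.MathematicalPhysics.QuantumFieldTheory.Balaban1983to89.B5G183RateTorus (cpt)
open Literature.MathematicalPhysics.QuantumFieldTheory.Balaban1983to89.B5G183RateTorusW (off)
open Summit.QuantumFields.BalabanUV.T4Continuum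
open Summit.QuantumFields.BalabanUV.T4Continuum.BalabanAveragedTowerModes (par rem val_par par_cpt_add_off cpt_par_add_off_rem)
open Summit.QuantumFields.BalabanUV.T4Continuum.BlockPairingGeometry (tau parT par_add_unitVec)
open Summit.QuantumFields.BalabanUV.T4Continuum.BalabanBlockPoincare (off_eq_sum_tstep)
open Summit.QuantumFields.BalabanUV.T4Continuum.CovariantLinePlanting (par_add_tstep)
open Summit.QuantumFields.BalabanUV.T4Continuum.NE2FromNE3BavgBridge (norm_sub_tstep_le)

variable {d : ℕ}

/-! ## §3 Parent consistency: the refined family stays within `2d` Lipschitz units of its parent -/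

section Parent

variable (N R : ℕ) [NeZero N] [NeZero R] (M : Fin d → ℕ) [hM : ∀ μ, NeZero (M μ)]
variable {E : Type*} [NormedAddCommGroup E] [NormedSpace ℂ E]

omit [NeZero N] [NeZero R] hM in
/-- `tstep` is additive in the step count. [folklore] -/
theorem tstep_add' {Nf : Fin d → ℕ} (μ : Fin d) (a b : ℕ) : tstep Nf μ (a + b) = tstep Nf μ a + tstep Nf μ b := by
  funext ν
  by_cases h : ν = μ
  · simp [tstep, h]
  · simp [tstep, h]

omit [NeZero N] [NeZero R] hM in
/-- a sum of own-direction steps over `s` does not move the coordinates outside `s`. [folklore] -/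
theorem apply_add_sum_tstep_of_not_mem {Nf : Fin d → ℕ} (y : Tor Nf) (c : Fin d → ℕ) {s : Finset (Fin d)} {ν : Fin d} (hν : ν ∉ s) :
    (y + ∑ μ ∈ s, tstep Nf μ (c μ)) ν = y ν := by
  rw [Pi.add_apply, Finset.sum_apply, Finset.sum_eq_zero, add_zero]
  intro μ hμ
  have h : ν ≠ μ := fun h => hν (h ▸ hμ)
  simp [tstep, h]

/-- **THE PARENT OF A SITE SHIFTED BY A BLOCK OFFSET**: `par (y + off j) = par y + Σ_ν carry_ν·e_ν` with `carry_ν = [R ≤ rem_ν(y) + j_ν] ∈ {0, 1}`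
(each coordinate crosses at most one block face). [folklore] -/
theorem par_add_off (y : Tor (fine (R * N) M)) (j : Fin d → Fin R) :
    par N R M (y + off N R M j)
      = par N R M y + ∑ ν, tstep (fine N M) ν (if R ≤ (y ν).val % R + (j ν : ℕ) then 1 else 0) := by
  rw [off_eq_sum_tstep N R M j]
  -- induction over the set of directions
  suffices h : ∀ s : Finset (Fin d), par N R M (y + ∑ ν ∈ s, tstep (fine (R * N) M) ν (j ν : ℕ))
      = par N R M y + ∑ ν ∈ s, tstep (fine N M) ν (if R ≤ (y ν).val % R + (j ν : ℕ) then 1 else 0) from h Finset.univ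
  intro s
  induction s using Finset.induction_on with
  | empty => simp
  | @insert a s ha ih =>
    rw [Finset.sum_insert ha, Finset.sum_insert ha, add_comm (tstep _ a _), ← add_assoc, par_add_tstep N R M a _ (j a).isLt, ih,
      apply_add_sum_tstep_of_not_mem y (fun μ => (j μ : ℕ)) ha]
    split_ifs with h
    · rw [tstep_succ, tstep_zero, zero_add, add_comm (unitVec _ a), add_assoc]
    · rw [tstep_zero, zero_add]

omit [NeZero N] [NeZero R] hM [NormedSpace ℂ E] in
/-- **ALONG A SUM OF OWN-DIRECTION STEPS** (any torus): `‖f (p + Σ_{ν∈s} c_ν e_ν, a) − f (p, a)‖ ≤ (Σ_{ν∈s} c_ν)·lip`. [folklore] -/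
theorem norm_sub_sum_tstep_le' {Nf : Fin d → ℕ} [∀ μ, NeZero (Nf μ)] (f : Tor Nf × Fin d → E) {lip : ℝ}
    (hlip : ∀ ν i, ‖f (tau Nf ν i) - f i‖ ≤ lip) (p : Tor Nf) (a : Fin d) (c : Fin d → ℕ) (s : Finset (Fin d)) :
    ‖f (p + ∑ ν ∈ s, tstep Nf ν (c ν), a) - f (p, a)‖ ≤ (∑ ν ∈ s, (c ν : ℝ)) * lip := by
  induction s using Finset.induction_on with
  | empty => rw [Finset.sum_empty, Finset.sum_empty, add_zero, sub_self, norm_zero, zero_mul]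
  | @insert ν s hν ih =>
    have e : p + ∑ μ ∈ insert ν s, tstep Nf μ (c μ) = (p + ∑ μ ∈ s, tstep Nf μ (c μ)) + tstep Nf ν (c ν) := by
      rw [Finset.sum_insert hν, add_assoc, add_comm (tstep _ ν _)]
    rw [e, Finset.sum_insert hν, add_mul]
    calc ‖f (p + ∑ μ ∈ s, tstep Nf μ (c μ) + tstep Nf ν (c ν), a) - f (p, a)‖
        ≤ ‖f (p + ∑ μ ∈ s, tstep Nf μ (c μ) + tstep Nf ν (c ν), a) - f (p + ∑ μ ∈ s, tstep Nf μ (c μ), a)‖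
            + ‖f (p + ∑ μ ∈ s, tstep Nf μ (c μ), a) - f (p, a)‖ := norm_sub_le_norm_sub_add_norm_sub _ _ _
      _ ≤ (c ν : ℝ) * lip + (∑ μ ∈ s, (c μ : ℝ)) * lip := add_le_add (norm_sub_tstep_le f hlip _ a ν (c ν)) ih

omit [NeZero R] [NormedSpace ℂ E] in
/-- a path of own-direction steps with at most two steps per direction has length `≤ 2d`: the norm bound. [folklore] -/
theorem norm_sub_le_of_short_path {w : Tor (fine N M) × Fin d → E} {lip : ℝ} (hlip0 : 0 ≤ lip)
    (hlip : ∀ ν i, ‖w (tau (fine N M) ν i) - w i‖ ≤ lip) (p : Tor (fine N M)) (a : Fin d) (c : Fin d → ℕ) (hc : ∀ ν, c ν ≤ 2) :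
    ‖w (p + ∑ ν, tstep (fine N M) ν (c ν), a) - w (p, a)‖ ≤ 2 * d * lip := by
  have hsum : ∑ ν : Fin d, (c ν : ℝ) ≤ 2 * d := by
    calc ∑ ν : Fin d, (c ν : ℝ) ≤ ∑ _ν : Fin d, (2 : ℝ) := Finset.sum_le_sum fun ν _ => by exact_mod_cast hc ν
      _ = 2 * d := by rw [Finset.sum_const, Finset.card_univ, Fintype.card_fin, nsmul_eq_mul, mul_comm]
  exact (norm_sub_sum_tstep_le' w hlip p a c Finset.univ).trans (mul_le_mul_of_nonneg_right hsum hlip0)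

omit [NormedSpace ℂ E] in
/-- **TWO BLOCK OFFSETS MOVE THE PARENT BY AT MOST `2d` UNIT STEPS**: for a lattice-Lipschitz coarse family,
`‖w (parT (y + off j + off j′, a)) − w (parT (y, a))‖ ≤ 2d·lip`. [folklore] -/
theorem norm_parT_add_off_add_off_sub_le {w : Tor (fine N M) × Fin d → E} {lip : ℝ} (hlip0 : 0 ≤ lip)
    (hlip : ∀ ν i, ‖w (tau (fine N M) ν i) - w i‖ ≤ lip) (y : Tor (fine (R * N) M)) (a : Fin d) (j j' : Fin d → Fin R) :
    ‖w (parT N R M (y + off N R M j + off N R M j', a)) - w (parT N R M (y, a))‖ ≤ 2 * d * lip := by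
  have hpar : par N R M (y + off N R M j + off N R M j') = par N R M y
      + ∑ ν, tstep (fine N M) ν ((if R ≤ (y ν).val % R + (j ν : ℕ) then 1 else 0)
          + (if R ≤ ((y + off N R M j) ν).val % R + (j' ν : ℕ) then 1 else 0)) := by
    rw [par_add_off, par_add_off, add_assoc, ← Finset.sum_add_distrib]
    congr 1
    refine Finset.sum_congr rfl fun ν _ => ?_
    rw [tstep_add']
  show ‖w (par N R M (y + off N R M j + off N R M j'), a) - w (par N R M y, a)‖ ≤ 2 * d * lip
  rw [hpar]
  exact norm_sub_le_of_short_path N M hlip0 hlip (par N R M y) a _ fun ν => by split_ifs <;> omega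

/-- **PARENT CONSISTENCY OF THE SUBDIVISION**: `(∀ μ i, ‖w (τ_μ i) − w i‖ ≤ b) → 0 ≤ b → ‖subdiv w x − w (parT x)‖ ≤ 2d·b` — every value
averaged into `subdiv w x` is `w` at a coarse site at most `2d` unit steps from `parT x`. [folklore] -/
theorem norm_subdiv_sub_parT_le {w : Tor (fine N M) × Fin d → E} {b : ℝ} (hb : 0 ≤ b) (hw : ∀ μ i, ‖w (tau (fine N M) μ i) - w i‖ ≤ b)
    (x : Tor (fine (R * N) M) × Fin d) :
    ‖subdiv N R M w x - w (parT N R M x)‖ ≤ 2 * d * b := by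
  have e : subdiv N R M w x - w (parT N R M x)
      = boxAvg N R M (fun y => boxAvg N R M (fun z => pullback N R M w z - w (parT N R M x)) y) x := by
    have h1 : ∀ y, boxAvg N R M (fun z => pullback N R M w z - w (parT N R M x)) y
        = boxAvg N R M (pullback N R M w) y - w (parT N R M x) := fun y => by
      have h := boxAvg_sub (pullback N R M w) (fun _ => w (parT N R M x)) y
      rw [boxAvg_const] at h
      exact h.symm
    have h2 := boxAvg_sub (boxAvg N R M (pullback N R M w)) (fun _ => w (parT N R M x)) x
    rw [boxAvg_const] at h2
    unfold subdiv
    rw [h2]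
    congr 1
    funext y
    exact (h1 y).symm
  rw [e]
  refine norm_invRd_smul_sum_le fun j => norm_invRd_smul_sum_le fun j' => ?_
  exact norm_parT_add_off_add_off_sub_le N R M hb hw x.1 x.2 j j'

end Parent

end Summit.QuantumFields.BalabanUV.T4Continuum.RegularTowerSubdivision

end
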